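/-
Copyright: public-domain mathematics; typed transcription for the H21 Literature library (cell lit-balaban,
Phase-2 proof seat p38 gen 7 = literature-prover-lit-balaban-p38-g7-0).

statement-level skeleton of published theorems with citation tags; proofs where landed; nothing here is a claim about the Yang–Mills mass gap

# Bałaban, *Propagators and renormalization transformations for lattice gauge theories. I*,
# Commun. Math. Phys. **95** (1984) 17–40 — `B5Local114.Realisation` INHABITED FOR THE OPERATOR `G = Δ_a⁻¹` OF RECORD
# ON B5's TORI, and (1.114) FOR G BY THE PRINTED RANDOM-WALK ROUTE (1.118)–(1.131) (p. 39; step S1′ in the labelling of `B5.prop12_of_printed_steps`)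

[cite: Balaban1984PropagatorsI]  T. Bałaban, Commun. Math. Phys. 95 (1984) 17–40.  p. 36 Prop. 1.2 (1.114); p. 36 «A proof of
Proposition 1.2 will be given in several steps. In the first step we will show that the inequalities (1.115)–(1.117), (1.89) imply the
proposition»; p. 39 «Thus we have to prove inequalities (1.115)–(1.117). Let us notice that the proof of inequalities (1.114), describing
the decay in L²-norms, is completed because we have proved inequalities (1.89)»; p. 39 «Let us notice that the constant O(1) under the sum
above is an absolute constant depending on d only, hence we can fix M₀ depending on d only, such that the series is convergent. This M₀
is approximately equal to the norm O(1) in the inequalities (1.115), (1.128)»; pp. 36–38 (1.118)–(1.131); p. 33 Prop. 1.1 (1.89)–(1.90);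
p. 38 (1.126)–(1.127).

WHAT THIS MODULE ADDS (SKELETON row B5.Prop1.2 (1.114) for G, second proof by the printed route; GAPS G-B5-03 («no value of M₀(d)»:
here `M₀ = ⌈max{1, 3/δ′₀, 4γ₀⁻¹θ̄K̄}⌉` of `B5Local114.local114_of_realisation` with the EXPLICIT `θ̄ = thetaW d a`, `K̄ = K_d(1/4)` below),
G-B5-24 (the located leaves of `B5Local114` inhabited for the torus of record); owner r02's `B5Local114.Realisation`, whose docstring
reads «Nothing in this structure is proved in this file: it is the hypothesis of local114_of_realisation, to be instantiated on the concrete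
torus model»):
* `kdW n M` — the kernel data of record `(T_η, |x−x′|, η^{−d}Σ_{μν}‖(∂P∂*)_{(x,μ),(x′,ν)}‖)` (definitionally gen-6's `B5Carrier132Pieces.kd`
  at `n = L^K`, `M = (2L^m,…)`), and `kernel126_127_kdW_fam` — `B5.Kernel126_127Printed` for it over B5's top-level tori, from p16's
  PROVED (1.126)–(1.127) `B5PBridgeKernel126.holder_GradOp_PcT_GradOp_adjoint` (constants `d²C`, `d²C_α`, same `δ′₀`);
* `κW d a : B5Local114.Consts` — the uniform constants: `c̄ = 4`, `ν = 33^d`, `K̄ = K_d(1/4)`, `θ̄(δ′₀,C) = thetaW d a δ′₀ C`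
  (`B5WalkH128Torus`), `c_F, c_L, c₁` (`B5WalkCertsTorus`) — functions of `d, a` (and of `γ₀, δ′₀, C`) only;
* **`realisationW`** — `B5Local114.Realisation (latticeSettingP12R n M a k) (kdW n M) M₀ (κW d a) (Vsp n M) (TorR M) (Cen M M₀)` for
  every `n ≥ 1`, every torus `M`, every `a > 0`, every `k`, every cube scale `M₀ ≥ 1`: ALL 28 FIELDS from `B5WalkTorusGeom` …
  `B5WalkCertsTorus`;
* `prop11Printed_famG` — Prop. 1.1 for the family of record with `γ₀ = gammaZero d a` (r02's `l2op189_le`, `ineq190_form`);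
* **`local114Fam_famG_walk (hd : 1 ≤ d) (ha : 0 < a) : B5.Local114Fam (famG d L a)`** — (1.114) FOR `G = Δ_a⁻¹` ON THE TORUS FAMILY OF
  RECORD BY THE PRINTED RANDOM-WALK ROUTE: `local114_of_realisation` fed with `realisationW`, `prop11Printed_famG`,
  `kernel126_127_kdW_fam`.  (The tree's first proof, p37's `B5Prop12GHolds.local114Fam_famG`, goes by Combes–Thomas; the statement of
  record is unchanged.)

HONEST SCOPE.  L² version of the walk (p. 39; step S1′ in the labelling of `B5.prop12_of_printed_steps`), which is what (1.114) asserts; the Hölder-norm walk for (1.110)–(1.113) (p. 36, step S1)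
is not done here (the tree obtains (1.110)–(1.113) by the (1.132)/(1.133) transfer, `B5Prop12GLattice`).  The analytic inputs are the
tree's PROVED Prop. 1.1 (r02) and (1.126)–(1.127) (p16/b05); `d ≥ 1` is needed only for the latter's packaging.  value = the located
leaf structure of `B5Local114` inhabited for the operator of record + a second, printed-route proof of (1.114) for G — NOT summit progress.
-/
import Mathlib
import Literature.MathematicalPhysics.QuantumFieldTheory.Balaban1983to89.B5WalkCertsTorus
import Literature.MathematicalPhysics.QuantumFieldTheory.Balaban1983to89.B5PBridgeKernel126
import Literature.MathematicalPhysics.QuantumFieldTheory.Balaban1983to89.B5Prop12GLattice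

open scoped BigOperators Real Matrix ComplexConjugate
open Finset Matrix

namespace Literature.MathematicalPhysics.QuantumFieldTheory.Balaban1983to89.B5WalkRealisationTorus

open Literature.MathematicalPhysics.QuantumFieldTheory.Balaban1983to89
open Literature.MathematicalPhysics.QuantumFieldTheory.Balaban1983to89.B5Prop11Plancherel (Tor fine)
open Literature.MathematicalPhysics.QuantumFieldTheory.Balaban1983to89.B5Prop11Lattice (gammaZero gammaZero_pos ineq190_form)
open Literature.MathematicalPhysics.QuantumFieldTheory.Balaban1983to89.B5Prop11SettingModel (locNorm l2op189 l2op189_le)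
open Literature.MathematicalPhysics.QuantumFieldTheory.Balaban1983to89.B5Prop12FieldsLattice (distU distU_nonneg cutSupL_nonneg)
open Literature.MathematicalPhysics.QuantumFieldTheory.Balaban1983to89.B5Action121 (GradOp)
open Literature.MathematicalPhysics.QuantumFieldTheory.Balaban1983to89.B5Value126 (PcT)
open Literature.MathematicalPhysics.QuantumFieldTheory.Balaban1983to89.B4Sect5Proof (latticeConst latticeConst_nonneg)
open Literature.MathematicalPhysics.QuantumFieldTheory.Balaban1983to89.B5Local114 (Realisation Kop local114_of_realisation)
open Literature.MathematicalPhysics.QuantumFieldTheory.Balaban1983to89.B5Walk131 (twoDelta0)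
open Literature.MathematicalPhysics.QuantumFieldTheory.Balaban1983to89.B5SettingP12Weighted (sqEta sqEta_nonneg)
open Literature.MathematicalPhysics.QuantumFieldTheory.Balaban1983to89.B5SettingP12Real (LocR embV latticeSettingP12R)
open Literature.MathematicalPhysics.QuantumFieldTheory.Balaban1983to89.B5SiteBridgeP12 (nP MP one_le_nP)
open Literature.MathematicalPhysics.QuantumFieldTheory.Balaban1983to89.B5ResidualGpTorusHolds (TopIdx)
open Literature.MathematicalPhysics.QuantumFieldTheory.Balaban1983to89.B5Prop12GLattice (famG)
open Literature.MathematicalPhysics.QuantumFieldTheory.Balaban1983to89.B5PBridgeKernel126 (holder_GradOp_PcT_GradOp_adjoint)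
open Literature.MathematicalPhysics.QuantumFieldTheory.Balaban1983to89.B5WalkTorusGeom (TorR sitePt Cen ctr distSite_le_dist_sitePt
  rowSum_ctr_le card_near_ctr_le)
open Literature.MathematicalPhysics.QuantumFieldTheory.Balaban1983to89.B5WalkCarrierTorus (Bnd Vsp Gop DAop Hop Dg DAop_mul_Gop
  Gop_mul_DAop Gop_symm h118_Hop Hop_symm h89_holds)
open Literature.MathematicalPhysics.QuantumFieldTheory.Balaban1983to89.B5WalkEntriesTorus (cut cut_symm norm_cut_le vsrc hvec_holds
  D1v D2v Dadjv hentry_holds)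
open Literature.MathematicalPhysics.QuantumFieldTheory.Balaban1983to89.B5WalkLocalityTorus (hJloc_holds)
open Literature.MathematicalPhysics.QuantumFieldTheory.Balaban1983to89.B5WalkH128Torus (VC thetaW thetaW_nonneg h128_holds)
open Literature.MathematicalPhysics.QuantumFieldTheory.Balaban1983to89.B5WalkCertsTorus (cF cL c1 cF_nonneg cL_nonneg c1_nonneg
  hcert_holds)

noncomputable section

variable {d : ℕ}

/-! ## §1 The kernel data of record and its (1.126)–(1.127) -/

section Kernel

variable (n : ℕ) [NeZero n] (M : Fin d → ℕ) [hM : ∀ μ, NeZero (M μ)]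

/-- **the kernel data of record** `(T_η, |x − x′|, (∂P∂*)(x,x′) := η^{−d}·Σ_{μν}‖V_{(x,μ),(x′,ν)}‖)` with `V = ∂·PcT·∂ᴴ` r02's matrix of
record (the `η^d`-weighted kernel convention (1.120); definitionally gen-6's `B5Carrier132Pieces.kd P` at `n = L^K`, `M = (2L^m,…)`).
[cite: Balaban1984PropagatorsI, (1.126) p.38, (1.120) p.37] -/
def kdW : B5.KernelData :=
  ⟨Tor (fine n M), distU n M, fun x x' => ((n : ℝ) ^ d) * ∑ μ : Fin d, ∑ ν : Fin d, ‖VC n M (x, μ) (x', ν)‖⟩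

variable {n M}

/-- from the summed kernel bound back to the entries: `‖V_{ij}‖ ≤ C·η^d·e^{−δ|x_i−x_j|}`. [cite: Balaban1984PropagatorsI, (1.126) p.38] -/
theorem entry_le_of_kdW {C δ : ℝ} (h : ∀ x x' : (kdW n M).X, |(kdW n M).ker x x'| ≤ C * Real.exp (-(δ * (kdW n M).dist x x')))
    (i j : Bnd n M) : ‖VC n M i j‖ ≤ C * ((n : ℝ) ^ d)⁻¹ * Real.exp (-(δ * distU n M i.1 j.1)) := by
  have hn : (0 : ℝ) < (n : ℝ) ^ d := pow_pos (Nat.cast_pos.mpr (NeZero.pos n)) _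
  have hk := h i.1 j.1
  change |((n : ℝ) ^ d) * ∑ μ : Fin d, ∑ ν : Fin d, ‖VC n M (i.1, μ) (j.1, ν)‖| ≤ C * Real.exp (-(δ * distU n M i.1 j.1)) at hk
  have hS : 0 ≤ ∑ μ : Fin d, ∑ ν : Fin d, ‖VC n M (i.1, μ) (j.1, ν)‖ :=
    Finset.sum_nonneg fun _ _ => Finset.sum_nonneg fun _ _ => norm_nonneg _
  rw [abs_of_nonneg (mul_nonneg hn.le hS)] at hk
  have h1 : ‖VC n M i j‖ ≤ ∑ μ : Fin d, ∑ ν : Fin d, ‖VC n M (i.1, μ) (j.1, ν)‖ := by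
    have hν : ‖VC n M (i.1, i.2) (j.1, j.2)‖ ≤ ∑ ν : Fin d, ‖VC n M (i.1, i.2) (j.1, ν)‖ :=
      Finset.single_le_sum (f := fun ν => ‖VC n M (i.1, i.2) (j.1, ν)‖) (fun _ _ => norm_nonneg _) (Finset.mem_univ j.2)
    have hμ : ∑ ν : Fin d, ‖VC n M (i.1, i.2) (j.1, ν)‖ ≤ ∑ μ : Fin d, ∑ ν : Fin d, ‖VC n M (i.1, μ) (j.1, ν)‖ :=
      Finset.single_le_sum (f := fun μ => ∑ ν : Fin d, ‖VC n M (i.1, μ) (j.1, ν)‖)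
        (fun _ _ => Finset.sum_nonneg fun _ _ => norm_nonneg _) (Finset.mem_univ i.2)
    exact hν.trans hμ
  calc ‖VC n M i j‖ ≤ ∑ μ : Fin d, ∑ ν : Fin d, ‖VC n M (i.1, μ) (j.1, ν)‖ := h1
    _ = ((n : ℝ) ^ d)⁻¹ * (((n : ℝ) ^ d) * ∑ μ : Fin d, ∑ ν : Fin d, ‖VC n M (i.1, μ) (j.1, ν)‖) := by
        rw [← mul_assoc, inv_mul_cancel₀ hn.ne', one_mul]
    _ ≤ ((n : ℝ) ^ d)⁻¹ * (C * Real.exp (-(δ * distU n M i.1 j.1))) := mul_le_mul_of_nonneg_left hk (inv_nonneg.mpr hn.le)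
    _ = _ := by ring

end Kernel

/-- **(1.126)–(1.127) FOR THE KERNEL DATA OF RECORD over B5's top-level tori of dimension `d ≥ 1`** (`B5.Kernel126_127Printed`), with
constants `δ′₀`, `d²C + 1`, `d²C_α` depending on `d` (and `α`) only — from p16's PROVED typed-operator form
`B5PBridgeKernel126.holder_GradOp_PcT_GradOp_adjoint`. [cite: Balaban1984PropagatorsI, (1.126)–(1.127) p.38 («The constant O(1) in (1.126) depends on d only, and in (1.127) it depends on α also»)] -/
theorem kernel126_127_kdW_fam (hd : 1 ≤ d) (L : ℕ) : B5.Kernel126_127Printed (fun i : TopIdx d L => kdW (nP i.P) (MP i.P)) := by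
  obtain ⟨d', rfl⟩ : ∃ d', d = d' + 1 := ⟨d - 1, by omega⟩
  obtain ⟨δ, C, Cα, hδ, hC, h⟩ := holder_GradOp_PcT_GradOp_adjoint d'
  have key : ∀ (e : ℕ), e = d' + 1 → ∀ (n : ℕ) [NeZero n] (M : Fin e → ℕ) [∀ μ, NeZero (M μ)],
      (∀ x x' : (kdW n M).X, |(kdW n M).ker x x'| ≤ ((((d' + 1 : ℕ) : ℝ)) ^ 2 * C + 1) * Real.exp (-(δ * (kdW n M).dist x x'))) ∧
      (∀ (α : ℝ) (x x' x'' : (kdW n M).X), α < 1 → (kdW n M).dist x x' ≤ 1 →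
        |(kdW n M).ker x x'' - (kdW n M).ker x' x''|
          ≤ (((d' + 1 : ℕ) : ℝ) ^ 2 * Cα α) * (kdW n M).dist x x' ^ α * Real.exp (-(δ * (kdW n M).dist x x''))) := by
    intro e he n _ M _
    subst he
    have hn : (0 : ℝ) < (n : ℝ) ^ (d' + 1) := pow_pos (Nat.cast_pos.mpr (NeZero.pos n)) _
    refine ⟨fun x x' => ?_, fun α x x' x'' hα hxx' => ?_⟩
    · change |((n : ℝ) ^ (d' + 1)) * ∑ μ, ∑ ν, ‖VC n M (x, μ) (x', ν)‖| ≤ _ * Real.exp (-(δ * distU n M x x'))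
      have hS : 0 ≤ ∑ μ : Fin (d' + 1), ∑ ν : Fin (d' + 1), ‖VC n M (x, μ) (x', ν)‖ :=
        Finset.sum_nonneg fun _ _ => Finset.sum_nonneg fun _ _ => norm_nonneg _
      rw [abs_of_nonneg (mul_nonneg hn.le hS)]
      have hs : ∑ μ : Fin (d' + 1), ∑ ν : Fin (d' + 1), ‖VC n M (x, μ) (x', ν)‖
          ≤ ∑ _μ : Fin (d' + 1), ∑ _ν : Fin (d' + 1), C * ((n : ℝ) ^ (d' + 1))⁻¹ * Real.exp (-(δ * distU n M x x')) :=
        Finset.sum_le_sum fun μ _ => Finset.sum_le_sum fun ν _ => (h n M μ ν).1 x x'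
      rw [Finset.sum_const, Finset.sum_const, Finset.card_univ, Fintype.card_fin, smul_smul, nsmul_eq_mul] at hs
      have hE := Real.exp_nonneg (-(δ * distU n M x x'))
      calc (n : ℝ) ^ (d' + 1) * ∑ μ, ∑ ν, ‖VC n M (x, μ) (x', ν)‖
          ≤ (n : ℝ) ^ (d' + 1) * ((((d' + 1) * (d' + 1) : ℕ) : ℝ) * (C * ((n : ℝ) ^ (d' + 1))⁻¹ * Real.exp (-(δ * distU n M x x')))) :=
            mul_le_mul_of_nonneg_left hs hn.le
        _ = (((d' + 1 : ℕ) : ℝ)) ^ 2 * C * Real.exp (-(δ * distU n M x x')) := by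
            field_simp
            push_cast
            ring
        _ ≤ _ := by nlinarith
    · change |((n : ℝ) ^ (d' + 1)) * ∑ μ, ∑ ν, ‖VC n M (x, μ) (x'', ν)‖ - ((n : ℝ) ^ (d' + 1)) * ∑ μ, ∑ ν, ‖VC n M (x', μ) (x'', ν)‖|
        ≤ _ * distU n M x x' ^ α * Real.exp (-(δ * distU n M x x''))
      change distU n M x x' ≤ 1 at hxx'
      rw [← mul_sub, ← Finset.sum_sub_distrib, abs_mul, abs_of_pos hn]
      simp_rw [← Finset.sum_sub_distrib]
      have hs : |∑ μ : Fin (d' + 1), ∑ ν : Fin (d' + 1), (‖VC n M (x, μ) (x'', ν)‖ - ‖VC n M (x', μ) (x'', ν)‖)|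
          ≤ ∑ _μ : Fin (d' + 1), ∑ _ν : Fin (d' + 1),
              Cα α * ((n : ℝ) ^ (d' + 1))⁻¹ * distU n M x x' ^ α * Real.exp (-(δ * distU n M x x'')) := by
        refine (Finset.abs_sum_le_sum_abs _ _).trans (Finset.sum_le_sum fun μ _ => ?_)
        refine (Finset.abs_sum_le_sum_abs _ _).trans (Finset.sum_le_sum fun ν _ => ?_)
        exact (abs_norm_sub_norm_le _ _).trans ((h n M μ ν).2 α x x' x'' hα hxx')
      rw [Finset.sum_const, Finset.sum_const, Finset.card_univ, Fintype.card_fin, smul_smul, nsmul_eq_mul] at hs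
      calc (n : ℝ) ^ (d' + 1) * |∑ μ, ∑ ν, (‖VC n M (x, μ) (x'', ν)‖ - ‖VC n M (x', μ) (x'', ν)‖)|
          ≤ (n : ℝ) ^ (d' + 1) * ((((d' + 1) * (d' + 1) : ℕ) : ℝ)
              * (Cα α * ((n : ℝ) ^ (d' + 1))⁻¹ * distU n M x x' ^ α * Real.exp (-(δ * distU n M x x'')))) :=
            mul_le_mul_of_nonneg_left hs hn.le
        _ = _ := by
            field_simp
            push_cast
            ring
  refine ⟨δ, (((d' + 1 : ℕ) : ℝ)) ^ 2 * C + 1, fun α => ((d' + 1 : ℕ) : ℝ) ^ 2 * Cα α, hδ, by positivity, fun i => ?_⟩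
  exact key i.P.d i.hPd (nP i.P) (MP i.P)

/-! ## §2 The uniform constants -/

/-- **THE UNIFORM CONSTANTS OF THE WALK for the torus of record** (functions of `d, a` only): `c̄ = 4`, `ν = 33^d`, `K̄ = K_d(1/4)`,
`θ̄(δ′₀, C) = thetaW d a |δ′₀| |C|`, `c_F, c_L, c₁` of `B5WalkCertsTorus` at `|γ₀|`. [cite: Balaban1984PropagatorsI, p.39 («an absolute constant depending on d only»)] -/
def κW (d : ℕ) (a : ℝ) : B5Local114.Consts where
  cbar := 4
  nu := 33 ^ d
  Kbar := latticeConst d (1 / 4)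
  thetaBar := fun δ C => thetaW d a |δ| (|C| + 1)
  cF := fun t => cF d |t|
  cL := fun t => cL d |t|
  c1 := fun t => c1 d |t|
  cbar_nonneg := by norm_num
  nu_nonneg := by positivity
  Kbar_nonneg := latticeConst_nonneg d (by norm_num)
  thetaBar_nonneg := fun δ C => by
    rcases eq_or_ne δ 0 with h0 | h0
    · subst h0
      unfold thetaW
      have := B5CoverP12Lattice.Lw_nonneg d
      have := B5WalkH128Torus.K2_nonneg
      simp only [abs_zero, mul_zero, div_zero, zero_mul, add_zero]
      positivity
    · exact thetaW_nonneg d a (abs_pos.mpr h0) (by positivity)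
  cF_nonneg := fun t => cF_nonneg (abs_nonneg t)
  cL_nonneg := fun t => cL_nonneg (abs_nonneg t)
  c1_nonneg := fun t => c1_nonneg (abs_nonneg t)

/-! ## §3 The realisation -/

section Real

variable (n : ℕ) [NeZero n] (M : Fin d → ℕ) [hM : ∀ μ, NeZero (M μ)] (a : ℝ) (k : ℕ) (M₀ : ℕ)

/-- **`B5Local114.Realisation` INHABITED FOR `G = Δ_a⁻¹` OF RECORD** on `T_η = Tor (fine n M) × {1..d}` (`η = 1/n`), every `n ≥ 1`,
every torus `M`, every `a > 0`, every `k`, every cube scale `M₀ ≥ 1`: carrier `V = ℓ²` over sites × components × grades {vec, ten, ten2}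
(`B5WalkCarrierTorus`), metric carrier the real torus, centres `(M₀ℤ)^d ∩ T` (`B5WalkTorusGeom`), `h_z` the product profile
(`B5WalkPartitionTorus`), entries/sources/cut-offs (`B5WalkEntriesTorus`), locality (`B5WalkLocalityTorus`), (1.128)
(`B5WalkH128Torus`), certificates (`B5WalkCertsTorus`). [cite: Balaban1984PropagatorsI, pp.36–39, (1.89) p.33, (1.114) p.36] -/
def realisationW (hn : 1 ≤ n) (ha : 0 < a) (hM₀ : 1 ≤ M₀) :
    Realisation (latticeSettingP12R n M a k) (kdW n M) M₀ (κW d a) (Vsp n M) (TorR M) (Cen M M₀) where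
  G := Gop n M a
  Δa := DAop n M a
  H := Hop n M M₀
  Dg := Dg n M
  ctr := ctr M M₀
  site := sitePt M
  vec := vsrc n M
  cut := cut n M
  D1 := D1v n M
  D2 := D2v n M
  Dadj := Dadjv n M
  h118 := h118_Hop
  h71 := DAop_mul_Gop hn ha
  h71' := Gop_mul_DAop hn ha
  symmG := Gop_symm hn ha
  symmH := Hop_symm
  symmCut := cut_symm
  hdist := distSite_le_dist_sitePt M
  hvec := hvec_holds a k
  hcut := norm_cut_le
  hcut0 := fun ζ => cutSupL_nonneg ζ
  hentry := hentry_holds a k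
  hν := fun x => by
    have h := card_near_ctr_le M hM₀ (by norm_num : (0 : ℝ) ≤ 4) x
    have e : ((8 : ℝ) * 4 + 1) ^ d = (κW d a).nu := by show ((8 : ℝ) * 4 + 1) ^ d = 33 ^ d; norm_num
    exact h.trans e.le
  hrow := fun z => rowSum_ctr_le M hM₀ z
  hJloc := fun m J y' hJ z hfar => hJloc_holds a k hn hM₀ (by show (11 : ℝ) / 3 ≤ 4; norm_num) m J y' hJ z hfar
  h89 := fun γ₀ hγ hcl => h89_holds hn γ₀ hγ hcl
  h128 := fun δ C hδ hC hker z₁ z₂ A => by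
    have hV := entry_le_of_kdW hker
    have hV' : ∀ i j : Bnd n M, ‖VC n M i j‖ ≤ (|C| + 1) * ((n : ℝ) ^ d)⁻¹ * Real.exp (-(|δ| * distU n M i.1 j.1)) := by
      intro i j
      rw [abs_of_pos hδ]
      refine (hV i j).trans (mul_le_mul_of_nonneg_right (mul_le_mul_of_nonneg_right ?_ (by positivity)) (Real.exp_nonneg _))
      rw [abs_of_pos hC]; linarith
    have h := h128_holds (a := a) hn hM₀ (abs_pos.mpr hδ.ne') (by positivity) hV' z₁ z₂ A
    rw [abs_of_pos hδ] at h
    have e : twoDelta0 |δ| M₀ = twoDelta0 δ M₀ := by rw [abs_of_pos hδ]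
    show ‖Hop n M M₀ z₁ (Kop (DAop n M a) (Hop n M M₀) z₂ A)‖
      ≤ thetaW d a |δ| (|C| + 1) / M₀ * Real.exp (-(twoDelta0 δ M₀ * dist (ctr M M₀ z₁) (ctr M M₀ z₂))) * (‖Dg n M A‖ + ‖A‖)
    rw [abs_of_pos hδ]
    exact h
  hcert := fun γ₀ hγ hcl m => by
    show B5Local114.RightCert (latticeSettingP12R n M a k) (Gop n M a) (Dg n M) (Hop n M M₀) (ctr M M₀) (sitePt M) (vsrc n M)
        (cut n M) (D1v n M m) (D2v n M m) (4 * M₀) (cF d |γ₀|) (cL d |γ₀|) (c1 d |γ₀|) ∨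
      B5Local114.LeftCert (latticeSettingP12R n M a k) (Gop n M a) (Hop n M M₀) (ctr M M₀) (sitePt M) (cut n M)
        (D1v n M m) (Dadjv n M m) (D2v n M m) (4 * M₀) (cF d |γ₀|)
    rw [abs_of_pos hγ]
    exact hcert_holds hn hM₀ hγ hcl (by norm_num : (11 : ℝ) / 3 ≤ 4) m

end Real

/-! ## §4 Proposition 1.1 for the family of record and the capstone -/

/-- **PROPOSITION 1.1 FOR THE G-FAMILY OF RECORD over B5's top-level tori**, `γ₀ = gammaZero d a` (r02's `l2op189_le`, `ineq190_form`).
[cite: Balaban1984PropagatorsI, Prop. 1.1 (1.89)–(1.90) p.33] -/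
theorem prop11Printed_famG (d L : ℕ) {a : ℝ} (ha : 0 < a) : B5.Prop11Printed (famG d L a) := by
  refine ⟨gammaZero d a, gammaZero_pos d a, fun i => ?_⟩
  obtain ⟨P, hPd, hPL, hK⟩ := i
  subst hPd
  refine ⟨fun m J => ?_, fun A => ?_⟩
  · change sqEta (nP P) P.d * l2op189 (nP P) (MP P) a m J.emb ≤ (gammaZero P.d a)⁻¹ * (sqEta (nP P) P.d * locNorm J.emb)
    calc sqEta (nP P) P.d * l2op189 (nP P) (MP P) a m J.emb ≤ sqEta (nP P) P.d * ((gammaZero P.d a)⁻¹ * locNorm J.emb) :=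
          mul_le_mul_of_nonneg_left (l2op189_le a ha m J.emb) (sqEta_nonneg _ _)
      _ = _ := by ring
  · exact ineq190_form (nP P) (one_le_nP P) (MP P) a ha (embV A)

/-- **THE REALISATION FOR EVERY MEMBER OF THE FAMILY OF RECORD AND EVERY CUBE SCALE.** [cite: Balaban1984PropagatorsI, pp.36–39] -/
def realisation_famG (d L : ℕ) {a : ℝ} (ha : 0 < a) :
    ∀ (i : TopIdx d L) (M₀ : ℕ), 1 ≤ M₀ →
      Realisation (famG d L a i) (kdW (nP i.P) (MP i.P)) M₀ (κW d a) (Vsp (nP i.P) (MP i.P)) (TorR (MP i.P)) (Cen (MP i.P) M₀)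
  | ⟨P, hPd, _, _⟩, M₀, hM₀ => by
      subst hPd
      exact realisationW (nP P) (MP P) a P.K M₀ (one_le_nP P) ha hM₀

/-- **(1.114) FOR `G = Δ_a⁻¹` ON THE TORUS FAMILY OF RECORD BY THE PRINTED RANDOM-WALK ROUTE (1.118)–(1.131)** (step S1′ of `B5.prop12_of_printed_steps`, p. 39):
`B5.Local114Fam (famG d L a)` for every `d ≥ 1`, every `L`, every `a > 0` — r02's `B5Local114.local114_of_realisation` (the walk, the
choice of `M₀(d)`, (1.131)) fed with the realisation of record `realisationW`, Prop. 1.1 (`prop11Printed_famG`) and (1.126)–(1.127)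
(`kernel126_127_kdW_fam`).  Second proof of the tree's `B5Prop12GHolds.local114Fam_famG` (Combes–Thomas), by the printed method.
[cite: Balaban1984PropagatorsI, Prop. 1.2 (1.114) p.36, pp.36–39] -/
theorem local114Fam_famG_walk {d : ℕ} (hd : 1 ≤ d) (L : ℕ) {a : ℝ} (ha : 0 < a) : B5.Local114Fam (famG d L a) :=
  local114_of_realisation (famG d L a) (fun i : TopIdx d L => kdW (nP i.P) (MP i.P)) (κW d a)
    (V := fun i _ => Vsp (nP i.P) (MP i.P)) (X := fun i _ => TorR (MP i.P)) (S := fun i M₀ => Cen (MP i.P) M₀)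
    (realisation_famG d L ha) (prop11Printed_famG d L ha) (kernel126_127_kdW_fam hd L)

end

end Literature.MathematicalPhysics.QuantumFieldTheory.Balaban1983to89.B5WalkRealisationTorus
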